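import Mathlib
import HarnessLib
import Summits.HubbardSuperconductivity.HubbardSuperconductivity.Theorems.KLProgrammeSWaveCascadeVariation
import Summits.HubbardSuperconductivity.HubbardSuperconductivity.Theorems.KLProgrammeSWaveCascadeArrayAllScales

/-!
# Route `KLProgramme` — row 0′ (child 1), CARRIER-GENERIC, at one total-momentum class: the TOTAL VARIATION ACROSS ALL SCALES of the ball amplitudes
# is `U`-currency (ladder part `(11/9)·U + (3/2)·(A+R)` inside the class, frozen part `Gtot + Xtot + Σε` after the exit)

Cell gate-hubbard-kl, seat hubbard-kl-k3c1-p1 (g19; child-1 lineage; technique «composed-map remainder propagation»).  Sequel to `…SWaveCascadeVariation`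
(`matrixLadder_variation_edge` / `amplitudeLadder_variation_edge`) and `…SWaveCascadeArrayAllScales` (`amplitudeArray_envelope_edge_allScales`, p701450), pen g25
(R372)(B) «CHILD1-ALLSCALES-EXPORT».  **`amplitudeArray_variation_edge`**: the hypotheses of `amplitudeArray_envelope_edge` (`…SWaveCascadeArrayEdge`) VERBATIM plus
`g ≥ 0` ⟹ everything `amplitudeArray_envelope_edge_allScales` exports (ONE comparison sequence `Us` with its exact Riccati law, signed masses, class structure,
negative-mass line, envelope at every `j ≤ n`) PLUS the in-class INCREMENT LAW `‖𝒜 (i+1) k k' − 𝒜 i k k' − (Us (i+1) − Us i)‖ ≤ m i·((2Ū + d + R)·d + R·Ū) + τ i + X (i+1) k k'`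
(`Ū = 16U/15`, `d = 12(A+R)`, `A = ι₀ + Στ + Xtot`, `R = Στ + Xsup`) PLUS the TOTAL VARIATION over the whole history
`Σ_{i<n} ‖𝒜 (i+1) k k' − 𝒜 i k k'‖ ≤ (11/9)·U + (3/2)·(A+R) + (Gtot + Xtot + Σ_{i<n} ε i)` on `B × B` — `U`-currency uniformly in `n`, at EVERY class INCLUDING the
one that is never left (the pinned transfer).  Proof: the ladder variation up to the last in-class scale `t` (`amplitudeLadder_variation_edge`, `A_t ≤ A_n`) and the
frozen increments `g + ε + X` summed over `(t, n]` (adapted from `amplitudeArray_envelope_edge_allScales`).  The model instance is `…KLRegimeSplitFlowPairArrayVariation`.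
Everything is proved; no definitions; nothing about the model is asserted; nothing asserts superconductivity.
-/

noncomputable section

namespace Summit.HubbardSuperconductivity.HubbardSuperconductivity.Theorems.SWaveCascade

set_option linter.dupNamespace false -- summit = problem name (single-conjunct summit), D-0017

open Finset

variable {S : Type*} [Fintype S] [DecidableEq S]

/-- Index shift `Σ_{i ∈ [t,n)} f (i+1) = Σ_{j ∈ (t,n]} f j`. -/
theorem sum_Ico_succ_eq_sum_Ioc (f : ℕ → ℝ) (t n : ℕ) : ∑ i ∈ Ico t n, f (i + 1) = ∑ j ∈ Ioc t n, f j := by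
  rw [← Finset.sum_image (s := Ico t n) (g := fun i => i + 1) (f := f) (fun a _ b _ h => by simpa using h)]
  refine Finset.sum_congr ?_ fun _ _ => rfl
  ext j
  simp only [mem_image, mem_Ico, mem_Ioc]
  constructor
  · rintro ⟨a, ⟨h1, h2⟩, rfl⟩; omega
  · intro h; exact ⟨j - 1, by omega, by omega⟩

/-- **Row 0′ at one total-momentum class, for an arbitrary amplitude family — ALL-SCALES EXPORT, INCREMENT LAW and `U`-CURRENCY TOTAL VARIATION.**
See the module docstring. -/
theorem amplitudeArray_variation_edge (B : Finset S) (𝒜 : ℕ → S → S → ℂ) (InClass : ℕ → Prop) [DecidablePred InClass]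
    (hmono : ∀ {j m : ℕ}, InClass m → j ≤ m → InClass j)
    {U b ι₀ Gtot : ℝ} (hU : 0 ≤ U) (hb : 0 ≤ b) (hι₀ : 0 ≤ ι₀) (hGtot0 : 0 ≤ Gtot) (τ ε : ℕ → ℝ) (hτ0 : ∀ j, 0 ≤ τ j)
    (hε0 : ∀ j, 0 ≤ ε j) {n : ℕ} (g X : ℕ → S → S → ℝ) {Xtot Xsup : ℝ} (hg0 : ∀ j k k', 0 ≤ g j k k')
    (hX0 : ∀ j k k', 0 ≤ X j k k') (hXtot0 : 0 ≤ Xtot) (hXsup0 : 0 ≤ Xsup) (hXsup : ∀ j k k', X j k k' ≤ Xsup)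
    (hXsum : ∀ (t : ℕ) (k k' : S), ∑ j ∈ Ioc t n, X j k k' ≤ Xtot)
    (hXtot : ∀ k k' : S, X 0 k k' + ∑ i ∈ range n, X (i + 1) k k' ≤ Xtot)
    (δ : ℕ → ℝ) (hneg : ∀ t ≤ n, InClass t → 16 * U * ∑ i ∈ range t, δ (i + 1) ≤ 1)
    (h0 : ∀ k ∈ B, ∀ k' ∈ B, ‖𝒜 0 k k' - (U : ℂ)‖ ≤ ι₀ + X 0 k k')
    (hsteps : ∀ j, 1 ≤ j → j ≤ n → InClass j →
      ∃ w : S → ℝ, (∑ p, |w p| ≤ b) ∧ (∑ p, (|w p| - w p) ≤ δ j) ∧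
        ∃ N : Matrix S S ℂ,
          (1 + Matrix.diagonal (fun p => (w p : ℂ)) * Matrix.of (fun s t => if s ∈ B ∧ t ∈ B then 𝒜 (j - 1) s t else 0)) * N = 1 ∧
          ∀ k ∈ B, ∀ k' ∈ B,
            ‖𝒜 j k k' - (Matrix.of (fun s t => if s ∈ B ∧ t ∈ B then 𝒜 (j - 1) s t else 0) * N) k k'‖ ≤ τ (j - 1) + X j k k')
    (hincr : ∀ j, 1 ≤ j → j ≤ n → ∀ k ∈ B, ∀ k' ∈ B, ‖𝒜 j k k' - 𝒜 (j - 1) k k'‖ ≤ g j k k' + ε (j - 1) + X j k k')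
    (hg : ∀ t ≤ n, ¬ InClass (t + 1) → ∀ k ∈ B, ∀ k' ∈ B, ∑ j ∈ Ioc t n, g j k k' ≤ Gtot)
    (hsmall : 8 * 42 * ((ι₀ + ∑ j ∈ range n, τ j + Xtot) + (∑ j ∈ range n, τ j + Xsup)) * (b * n) ≤ 1) :
    ∃ Us W m : ℕ → ℝ, Us 0 = U ∧ (∀ i, Us (i + 1) = Us i / (1 + W i * Us i)) ∧
      (∀ i, |W i| ≤ m i ∧ m i ≤ b) ∧
      (∀ i < n, InClass (i + 1) → m i - W i ≤ δ (i + 1)) ∧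
      (∀ i, (n ≤ i ∨ ¬ InClass (i + 1)) → W i = 0 ∧ m i = 0) ∧
      16 * U * ∑ i ∈ range n, (m i - W i) ≤ 1 ∧
      (∀ j ≤ n, 0 ≤ Us j ∧ Us j ≤ 16 / 15 * U ∧ ∀ k ∈ B, ∀ k' ∈ B,
        ‖𝒜 j k k' - (Us j : ℂ)‖ ≤
          12 * ((ι₀ + ∑ j ∈ range n, τ j + Xtot) + (∑ j ∈ range n, τ j + Xsup)) + (Gtot + Xtot + ∑ i ∈ range n, ε i)) ∧
      (∀ i < n, InClass (i + 1) → ∀ k ∈ B, ∀ k' ∈ B,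
        ‖𝒜 (i + 1) k k' - 𝒜 i k k' - ((Us (i + 1) - Us i : ℝ) : ℂ)‖ ≤
          m i * ((2 * (16 / 15 * U) + 12 * ((ι₀ + ∑ j ∈ range n, τ j + Xtot) + (∑ j ∈ range n, τ j + Xsup)) +
              (∑ j ∈ range n, τ j + Xsup)) * (12 * ((ι₀ + ∑ j ∈ range n, τ j + Xtot) + (∑ j ∈ range n, τ j + Xsup))) +
            (∑ j ∈ range n, τ j + Xsup) * (16 / 15 * U)) + τ i + X (i + 1) k k') ∧
      ∀ k ∈ B, ∀ k' ∈ B, ∑ i ∈ range n, ‖𝒜 (i + 1) k k' - 𝒜 i k k'‖ ≤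
        11 / 9 * U + 3 / 2 * ((ι₀ + ∑ j ∈ range n, τ j + Xtot) + (∑ j ∈ range n, τ j + Xsup)) + (Gtot + Xtot + ∑ i ∈ range n, ε i) := by
  classical
  have hSe0 : 0 ≤ ∑ i ∈ range n, ε i := sum_nonneg fun i _ => hε0 i
  have hSτ0 : 0 ≤ ∑ j ∈ range n, τ j := sum_nonneg fun j _ => hτ0 j
  -- the frozen part between two scales `t ≤ j ≤ n` once the class is left at `t + 1`
  have hfrozen : ∀ t j, t ≤ j → j ≤ n → ¬ InClass (t + 1) → ∀ k ∈ B, ∀ k' ∈ B,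
      ‖𝒜 j k k' - 𝒜 t k k'‖ ≤ Gtot + Xtot + ∑ i ∈ range n, ε i := by
    intro t j htj hjn hexit k hk k' hk'
    have h := amplitudeFrozen_increment 𝒜 htj g X ε hε0 (fun i hi hij => hincr i (by omega) (hij.trans hjn) k hk k' hk')
      ((sum_le_sum_of_subset_of_nonneg (Ioc_subset_Ioc_right hjn) fun i _ _ => hg0 i k k').trans
        (hg t (htj.trans hjn) hexit k hk k' hk'))
      ((sum_le_sum_of_subset_of_nonneg (Ioc_subset_Ioc_right hjn) fun i _ _ => hX0 i k k').trans (hXsum t k k'))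
    exact h.trans (add_le_add le_rfl (sum_le_sum_of_subset_of_nonneg (range_mono hjn) fun i _ _ => hε0 i))
  -- the frozen increments summed over `[t, n)`
  have hfrozenTV : ∀ t ≤ n, ¬ InClass (t + 1) → ∀ k ∈ B, ∀ k' ∈ B,
      ∑ i ∈ Ico t n, ‖𝒜 (i + 1) k k' - 𝒜 i k k'‖ ≤ Gtot + Xtot + ∑ i ∈ range n, ε i := by
    intro t htn hexit k hk k' hk'
    have h1 : ∑ i ∈ Ico t n, ‖𝒜 (i + 1) k k' - 𝒜 i k k'‖ ≤ ∑ i ∈ Ico t n, (g (i + 1) k k' + ε i + X (i + 1) k k') :=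
      sum_le_sum fun i hi => by
        have hi' := (mem_Ico.1 hi).2
        have h := hincr (i + 1) (Nat.le_add_left 1 i) (Nat.succ_le_of_lt hi') k hk k' hk'
        simp only [Nat.add_sub_cancel] at h
        exact h
    have h2 : ∑ i ∈ Ico t n, (g (i + 1) k k' + ε i + X (i + 1) k k') =
        ∑ j ∈ Ioc t n, g j k k' + ∑ i ∈ Ico t n, ε i + ∑ j ∈ Ioc t n, X j k k' := by
      rw [sum_add_distrib, sum_add_distrib, sum_Ico_succ_eq_sum_Ioc (fun j => g j k k'), sum_Ico_succ_eq_sum_Ioc (fun j => X j k k')]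
    have h3 : ∑ i ∈ Ico t n, ε i ≤ ∑ i ∈ range n, ε i :=
      sum_le_sum_of_subset_of_nonneg (fun i hi => mem_range.2 (mem_Ico.1 hi).2) fun i _ _ => hε0 i
    have h4 := hg t htn hexit k hk k' hk'
    have h5 := hXsum t k k'
    linarith
  by_cases hQ0 : InClass 0
  · -- the last in-class scale `t`
    set t : ℕ := Nat.findGreatest (fun s => InClass s) n with ht_def
    have htn : t ≤ n := Nat.findGreatest_le n
    have hQt : InClass t := Nat.findGreatest_spec (P := fun s => InClass s) (Nat.zero_le n) hQ0
    have hle_t : ∀ i, i ≤ n → InClass i → i ≤ t := fun i hin hQi => Nat.le_findGreatest hin hQi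
    have hexit_ge : ∀ i, ¬ InClass (i + 1) → t ≤ i := fun i hQi => by
      by_contra h
      exact hQi (hmono hQt (by omega))
    have hexit_t : t < n → ¬ InClass (t + 1) := fun h =>
      Nat.findGreatest_is_greatest (P := fun s => InClass s) (Nat.lt_succ_self t) (by omega)
    have hSt : ∑ j ∈ range t, τ j ≤ ∑ j ∈ range n, τ j :=
      sum_le_sum_of_subset_of_nonneg (range_mono htn) fun j _ _ => hτ0 j
    have hSt0 : 0 ≤ ∑ j ∈ range t, τ j := sum_nonneg fun j _ => hτ0 j
    -- the ladder data up to `t`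
    have hsteps' : ∀ i < t, ∃ w : S → ℝ, (∑ p, |w p| ≤ b) ∧ (∑ p, (|w p| - w p) ≤ δ (i + 1)) ∧
        ∃ N : Matrix S S ℂ,
          (1 + Matrix.diagonal (fun p => (w p : ℂ)) * Matrix.of (fun s t => if s ∈ B ∧ t ∈ B then 𝒜 i s t else 0)) * N = 1 ∧
          ∀ k ∈ B, ∀ k' ∈ B,
            ‖𝒜 (i + 1) k k' - (Matrix.of (fun s t => if s ∈ B ∧ t ∈ B then 𝒜 i s t else 0) * N) k k'‖ ≤ τ i + X (i + 1) k k' := by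
      intro i hi
      have h := hsteps (i + 1) (Nat.le_add_left 1 i) ((Nat.succ_le_of_lt hi).trans htn) (hmono hQt (Nat.succ_le_of_lt hi))
      simp only [Nat.add_sub_cancel] at h
      exact h
    have hXtot' : ∀ k k' : S, X 0 k k' + ∑ i ∈ range t, X (i + 1) k k' ≤ Xtot := fun k k' =>
      (add_le_add le_rfl (sum_le_sum_of_subset_of_nonneg (range_mono htn) fun i _ _ => hX0 _ _ _)).trans (hXtot k k')
    have hX0' : 0 ≤ (ι₀ + ∑ j ∈ range n, τ j + Xtot) + (∑ j ∈ range n, τ j + Xsup) := by linarith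
    have hARle : (ι₀ + ∑ j ∈ range t, τ j + Xtot) + (∑ j ∈ range t, τ j + Xsup) ≤
        (ι₀ + ∑ j ∈ range n, τ j + Xtot) + (∑ j ∈ range n, τ j + Xsup) := by linarith
    have hsmall' : 8 * 42 * ((ι₀ + ∑ j ∈ range t, τ j + Xtot) + (∑ j ∈ range t, τ j + Xsup)) * (b * t) ≤ 1 := by
      refine le_trans ?_ hsmall
      have ht' : (t : ℝ) ≤ n := by exact_mod_cast htn
      exact mul_le_mul (mul_le_mul_of_nonneg_left hARle (by norm_num)) (mul_le_mul_of_nonneg_left ht' hb)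
        (mul_nonneg hb (Nat.cast_nonneg t)) (mul_nonneg (by norm_num) hX0')
    obtain ⟨Us, W, m, hUs0, hlaw, hWm, hmb, hzero, hnegm, hdev, hinc, htv⟩ :=
      amplitudeLadder_variation_edge B 𝒜 (n := t) hU hι₀ τ hτ0 X hX0
        (fun i _ k k' => hXsup (i + 1) k k') hXtot' hXtot0 hXsup0 (fun i => δ (i + 1)) (hneg t htn hQt) h0 hsteps' hsmall'
    -- the comparison value is frozen from `t` on
    have hfrozenU : ∀ i, t ≤ i → Us i = Us t := by
      intro i hti
      induction i, hti using Nat.le_induction with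
      | base => rfl
      | succ i hti ih => rw [hlaw i, (hzero i hti).1, zero_mul, add_zero, div_one, ih]
    have hm0 : ∀ i, 0 ≤ m i := fun i => (abs_nonneg _).trans (hWm i)
    refine ⟨Us, W, m, hUs0, hlaw, fun i => ⟨hWm i, ?_⟩, fun i hi hQi => ?_, fun i hi => ?_, ?_, fun j hjn => ?_,
      fun i hi hQi k hk k' hk' => ?_, fun k hk k' hk' => ?_⟩
    · -- `m i ≤ b`
      rcases Nat.lt_or_ge i t with h | h
      · exact (hmb i h).1
      · rw [(hzero i h).2]; exact hb
    · -- the sign defect at an in-class step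
      exact (hmb i (Nat.lt_of_succ_le (hle_t (i + 1) (Nat.succ_le_of_lt hi) hQi))).2
    · -- past `n` or past the exit
      rcases hi with h | h
      · exact hzero i (htn.trans h)
      · exact hzero i (hexit_ge i h)
    · -- the negative-mass line: the defects vanish from `t` on
      rwa [← sum_subset (range_mono htn) fun i _ hit => by
        have hti : t ≤ i := by simp only [mem_range, not_lt] at hit; exact hit
        rw [(hzero i hti).1, (hzero i hti).2, sub_zero]]
    · -- the envelope at scale `j ≤ n`
      rcases le_or_gt j t with hjt | htj
      · obtain ⟨hUj0, hUjU, hd⟩ := hdev j hjt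
        refine ⟨hUj0, hUjU, fun k hk k' hk' => (hd k hk k' hk').trans ?_⟩
        nlinarith [hSt, hι₀, hSt0, hXtot0, hXsup0, hGtot0, hSe0]
      · obtain ⟨hUt0, hUtU, hd⟩ := hdev t le_rfl
        rw [hfrozenU j htj.le]
        refine ⟨hUt0, hUtU, fun k hk k' hk' => ?_⟩
        have hfro := hfrozen t j htj.le hjn (hexit_t (by omega)) k hk k' hk'
        have hlad := hd k hk k' hk'
        calc ‖𝒜 j k k' - (Us t : ℂ)‖ ≤ ‖𝒜 t k k' - (Us t : ℂ)‖ + ‖𝒜 j k k' - 𝒜 t k k'‖ := by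
              rw [show 𝒜 j k k' - (Us t : ℂ) = (𝒜 t k k' - (Us t : ℂ)) + (𝒜 j k k' - 𝒜 t k k') by ring]
              exact norm_add_le _ _
          _ ≤ _ := by
              refine (add_le_add hlad hfro).trans ?_
              nlinarith [hSt, hι₀, hSt0, hXtot0, hXsup0]
    · -- the increment law at an in-class step (`i < t`), constants weakened from `A_t` to `A_n`
      have hit : i < t := Nat.lt_of_succ_le (hle_t (i + 1) (Nat.succ_le_of_lt hi) hQi)
      refine (hinc i hit k hk k' hk').trans ?_
      have hRle : ∑ j ∈ range t, τ j + Xsup ≤ ∑ j ∈ range n, τ j + Xsup := by linarith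
      have hR0 : 0 ≤ ∑ j ∈ range t, τ j + Xsup := by linarith
      have hA0 : 0 ≤ (ι₀ + ∑ j ∈ range t, τ j + Xtot) + (∑ j ∈ range t, τ j + Xsup) := by linarith
      have hc : (2 * (16 / 15 * U) + 12 * ((ι₀ + ∑ j ∈ range t, τ j + Xtot) + (∑ j ∈ range t, τ j + Xsup)) +
              (∑ j ∈ range t, τ j + Xsup)) * (12 * ((ι₀ + ∑ j ∈ range t, τ j + Xtot) + (∑ j ∈ range t, τ j + Xsup))) +
            (∑ j ∈ range t, τ j + Xsup) * (16 / 15 * U) ≤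
          (2 * (16 / 15 * U) + 12 * ((ι₀ + ∑ j ∈ range n, τ j + Xtot) + (∑ j ∈ range n, τ j + Xsup)) +
              (∑ j ∈ range n, τ j + Xsup)) * (12 * ((ι₀ + ∑ j ∈ range n, τ j + Xtot) + (∑ j ∈ range n, τ j + Xsup))) +
            (∑ j ∈ range n, τ j + Xsup) * (16 / 15 * U) := by
        refine add_le_add (mul_le_mul (by linarith) (by linarith) (by positivity) (by positivity))
          (mul_le_mul_of_nonneg_right hRle (by positivity))
      linarith [mul_le_mul_of_nonneg_left hc (hm0 i)]
    · -- the total variation: ladder part up to `t`, frozen part on `[t, n)`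
      have hlad := htv k hk k' hk'
      have hsplit := (sum_range_add_sum_Ico (fun i => ‖𝒜 (i + 1) k k' - 𝒜 i k k'‖) htn).symm
      have hfro : ∑ i ∈ Ico t n, ‖𝒜 (i + 1) k k' - 𝒜 i k k'‖ ≤ Gtot + Xtot + ∑ i ∈ range n, ε i := by
        rcases htn.eq_or_lt with h | h
        · rw [h, Ico_self, sum_empty]; linarith
        · exact hfrozenTV t htn (hexit_t h) k hk k' hk'
      rw [hsplit]
      linarith [hARle, hlad, hfro]
  · -- never in the class: frozen from scale 0 around the bare value `U`
    have hexit : ¬ InClass (0 + 1) := fun h => hQ0 (hmono h (Nat.zero_le 1))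
    refine ⟨fun _ => U, fun _ => 0, fun _ => 0, rfl, fun i => by simp, fun i => ⟨by simp, hb⟩, fun i _ hQi => ?_,
      fun i _ => ⟨rfl, rfl⟩, by simp, fun j hjn => ⟨hU, by linarith, fun k hk k' hk' => ?_⟩, fun i _ hQi => ?_, fun k hk k' hk' => ?_⟩
    · exact absurd (hmono hQi (Nat.zero_le _)) hQ0
    · have hfro := hfrozen 0 j (Nat.zero_le j) hjn hexit k hk k' hk'
      have h0' := h0 k hk k' hk'
      have hX0le : X 0 k k' ≤ Xtot :=
        (le_add_of_nonneg_right (sum_nonneg fun i _ => hX0 (i + 1) k k')).trans (hXtot k k')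
      calc ‖𝒜 j k k' - (U : ℂ)‖ ≤ ‖𝒜 j k k' - 𝒜 0 k k'‖ + ‖𝒜 0 k k' - (U : ℂ)‖ := by
            rw [show 𝒜 j k k' - (U : ℂ) = (𝒜 j k k' - 𝒜 0 k k') + (𝒜 0 k k' - (U : ℂ)) by ring]
            exact norm_add_le _ _
        _ ≤ _ := by
            refine (add_le_add hfro h0').trans ?_
            nlinarith [hSτ0, hι₀, hXtot0, hXsup0, hX0le]
    · exact absurd (hmono hQi (Nat.zero_le _)) hQ0
    · have hfro := hfrozenTV 0 (Nat.zero_le n) hexit k hk k' hk'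
      rw [← range_eq_Ico] at hfro
      refine hfro.trans ?_
      nlinarith [hSτ0, hι₀, hXtot0, hXsup0, hU]

end Summit.HubbardSuperconductivity.HubbardSuperconductivity.Theorems.SWaveCascade

end
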